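import Summits.CriticalPhenomena.PercolationContinuityZ3.Theses.PercTiltedBlockers
import Literature.Probability.Percolation.SharpnessDCTProofs

/-!
Refutation of `PercTiltedBlockers.TiltGluing` (item stmt-CriticalPhenomena-6394).

The item quantifies over ALL bond configurations `ω : BondConfig (Site 3) = Set (Sym2 (Site 3))`,
and the tree's open graph `openGraph ω = SimpleGraph.fromEdgeSet ω` is NOT intersected with the
edge set of `ℤ³` (non-edges are closed only `P_p`-almost surely, `setBernoulli_ae_subset`).  So a
configuration may consist of the single non-lattice pair `s((0,0,0), (h,L+δ,0))`: this is an open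
path inside `U = [0,h]×[0,L+δ]×[0,M]` from the face `x₀ = 0` to the face `x₀ = h`, while inside
`R = [0,h]×[0,L]×[0,M]` and inside `R' = [0,h]×[δ,L+δ]×[0,M]` no pair is open at all (for `δ ≥ 1`
each endpoint lies in only one of the two boxes), so that both tilt hypotheses reduce to
"no single vertex lies in source ∩ target", which holds as soon as `1 ≤ a ≤ h`.
Witness: `h = L = δ = a = 1`, `M = 0`, `ω = {s((0,0,0), (1,2,0))}`.

Classification: refuted-MISSTATED.  The repaired statement adds the side condition
`ω ⊆ (zdGraph 3).edgeSet` after `∀ ω` (it holds `P_p`-a.s., which is all the squaring step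
`TiltSquaring` needs); with it the gluing lemma is TRUE and is proved as
`Summit.CriticalPhenomena.PercolationContinuityZ3.Theorems.tiltGluing_of_subset_edgeSet`
(`PercTiltedBlockersTiltGluingLattice.lean`).  The witness misses the repaired statement:
`s((0,0,0), (1,2,0))` is not an edge of `ℤ³`.
-/

namespace Summit.CriticalPhenomena.PercolationContinuityZ3.Theorems

open Literature.Probability.Percolation Literature.Probability.LatticeModels

/-- **Record of the replaced/dropped route item `TiltGluing`** = stmt-CriticalPhenomena-6394 (ledger signature verbatim, in
the route file's namespace; NOT a route item): after `not_TiltGluing` (below) closed the item `refuted` at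
4b37c9fb1fdd (2026-08-16T11:40Z), the route repair (rev 4, 2026-08-16T13:02Z: `drop`; the corrected
lattice version lives on as the route item `TiltGluingLattice`) removed this constant from the gate-written
Theses file, while the Theorems file below — append-only, statement text fixed — still names it
("Unknown identifier" in the full builds of 2026-08-16). Re-declared here under its original fully-qualified
name and definiens solely so that this record keeps elaborating. FALSE (refuted below). -/
def _root_.Summit.CriticalPhenomena.PercolationContinuityZ3.Theses.PercTiltedBlockers.TiltGluing : Prop :=
  ∀ (h L M δ a : ℕ), δ ≤ L → ∀ ω : Literature.Probability.Percolation.BondConfig (Literature.Probability.LatticeModels.Site 3), (¬ ∃ x ∈ Finset.Icc (0 : Literature.Probability.LatticeModels.Site 3) ![(h : ℤ), L, M], ∃ y ∈ Finset.Icc (0 : Literature.Probability.LatticeModels.Site 3) ![(h : ℤ), L, M], (x 0 = 0 ∨ (x 1 = L ∧ x 0 < a)) ∧ (y 0 = h ∨ (y 1 = δ ∧ (a : ℤ) ≤ y 0)) ∧ ω ∈ Literature.Probability.Percolation.openConnIn ↑(Finset.Icc (0 : Literature.Probability.LatticeModels.Site 3) ![(h : ℤ), L, M]) x y) → (¬ ∃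 x ∈ Finset.Icc (![0, (δ : ℤ), 0] : Literature.Probability.LatticeModels.Site 3) ![(h : ℤ), L + δ, M], ∃ y ∈ Finset.Icc (![0, (δ : ℤ), 0] : Literature.Probability.LatticeModels.Site 3) ![(h : ℤ), L + δ, M], (x 0 = 0 ∨ (x 1 = δ ∧ x 0 < a)) ∧ (y 0 = h ∨ (y 1 = L ∧ (a : ℤ) ≤ y 0)) ∧ ω ∈ Literature.Probability.Percolation.openConnIn ↑(Finset.Icc (![0, (δ : ℤ), 0] : Literature.Probability.LatticeModels.Site 3) ![(h : ℤ), L + δ, M]) x y) → ¬ ∃ x ∈ Finset.Icc (0 : Literature.Probability.LatticeModels.Site 3) ![(h : ℤ), L + δ, M], ∃ y ∈ Finset.Icc (0 : Literature.Probability.LatticeModels.Site 3) ![(h : ℤ), L + δ, M], x 0 = 0 ∧ y 0 = h ∧ ω ∈ Literature.Probability.Percolation.openConnIn ↑(Finset.Icc (0 : Literature.Probability.LatticeModels.Site 3) ![(h : ℤ), L + δ, M]) x y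

/-- Refutes `PercTiltedBlockers.TiltGluing` [refuted-misstated]: at `h = L = δ = a = 1`, `M = 0`
and the (non-lattice) configuration `ω = {s((0,0,0), (1,2,0))}`, both tilt hypotheses hold (no
pair inside `R = Icc 0 (1,1,0)` or inside `R' = Icc (0,1,0) (1,2,0)` is open, and no vertex of
either box lies in its source ∩ target), yet `(0,0,0) ↔ (1,2,0)` is an open path inside
`U = Icc 0 (1,2,0)` from `{x₀ = 0}` to `{x₀ = 1}`.  Repaired statement C′ (TRUE, proved as
`tiltGluing_of_subset_edgeSet`): insert `ω ⊆ (zdGraph 3).edgeSet →` after `∀ ω`; the witness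
misses C′ since `s((0,0,0), (1,2,0)) ∉ (zdGraph 3).edgeSet`. [folklore] -/
theorem not_TiltGluing :
    ¬ Summit.CriticalPhenomena.PercolationContinuityZ3.Theses.PercTiltedBlockers.TiltGluing := by
  intro hT
  classical
  -- the witness configuration: one non-lattice open pair from the bottom face to the top face
  let x : Site 3 := ![0, 0, 0]
  let y : Site 3 := ![1, 2, 0]
  let ω : BondConfig (Site 3) := {s(x, y)}
  have hxy : x ≠ y := by
    intro hxy
    have := congrFun hxy 0
    simp [x, y] at this
  -- inside a set missing `x` or missing `y`, `ω` has no open pair: connections are trivial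
  have htriv : ∀ (S : Set (Site 3)), (x ∉ S ∨ y ∉ S) → ∀ u v : Site 3,
      ω ∈ openConnIn S u v → u = v := by
    intro S hS u v huv
    refine DCT16.pathIn_induction (fun w => u = w) (DCT16.pathIn_of_mem_openConnIn huv) rfl ?_
    intro a b ha hb _ hab
    exfalso
    rw [openGraph_adj] at hab
    obtain ⟨hmem, -⟩ := hab
    have hmem' : s(a, b) = s(x, y) := by simpa [ω] using hmem
    rcases Sym2.eq_iff.1 hmem' with ⟨rfl, rfl⟩ | ⟨rfl, rfl⟩
    · exact hS.elim (fun h => h ha) (fun h => h hb)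
    · exact hS.elim (fun h => h hb) (fun h => h ha)
  have hyR : y ∉ ((Finset.Icc (0 : Site 3) ![((1 : ℕ) : ℤ), (1 : ℕ), (0 : ℕ)] : Finset (Site 3)) :
      Set (Site 3)) := by
    intro hy
    have := (Finset.mem_Icc.1 (Finset.mem_coe.1 hy)).2 1
    simp [y] at this
  have hxR' : x ∉ ((Finset.Icc (![0, ((1 : ℕ) : ℤ), 0] : Site 3)
      ![((1 : ℕ) : ℤ), (1 : ℕ) + (1 : ℕ), (0 : ℕ)] : Finset (Site 3)) : Set (Site 3)) := by
    intro hx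
    have := (Finset.mem_Icc.1 (Finset.mem_coe.1 hx)).1 1
    simp [x] at this
  refine hT 1 1 0 1 1 le_rfl ω ?_ ?_ ⟨x, ?_, y, ?_, by simp [x], by simp [y], ?_⟩
  · -- `R` is tilt-blocked: only trivial connections, and no vertex is in source ∩ target
    rintro ⟨u, hu, v, -, hsrc, htgt, hconn⟩
    have huv : u = v := htriv _ (Or.inr hyR) u v hconn
    subst huv
    have hu0 : 0 ≤ u 0 := (Finset.mem_Icc.1 hu).1 0
    push_cast at hsrc htgt
    omega
  · -- `R'` is tilt-blocked, for the same reason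
    rintro ⟨u, hu, v, -, hsrc, htgt, hconn⟩
    have huv : u = v := htriv _ (Or.inl hxR') u v hconn
    subst huv
    have hu0 : (![0, ((1 : ℕ) : ℤ), 0] : Site 3) 0 ≤ u 0 := (Finset.mem_Icc.1 hu).1 0
    simp only [Matrix.cons_val_zero] at hu0
    push_cast at hsrc htgt
    omega
  · -- `x ∈ U`
    refine Finset.mem_Icc.2 ⟨fun i => ?_, fun i => ?_⟩ <;> fin_cases i <;> simp [x]
  · -- `y ∈ U`
    refine Finset.mem_Icc.2 ⟨fun i => ?_, fun i => ?_⟩ <;> fin_cases i <;> simp [y]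
  · -- the open pair `x ↔ y` inside `U`
    refine DCT16.mem_openConnIn_of_pathIn (PathIn.of_adj ?_ ?_ ((openGraph_adj ω x y).2 ⟨rfl, hxy⟩))
    · refine Finset.mem_coe.2 (Finset.mem_Icc.2 ⟨fun i => ?_, fun i => ?_⟩) <;> fin_cases i <;>
        simp [x]
    · refine Finset.mem_coe.2 (Finset.mem_Icc.2 ⟨fun i => ?_, fun i => ?_⟩) <;> fin_cases i <;>
        simp [y]

end Summit.CriticalPhenomena.PercolationContinuityZ3.Theorems
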